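import Literature.Analysis.FunctionSpaces.TorusInverseLaplacian
import Summits.AnomalousDissipation.AnomalousDissipation.Theorems.QuasiStaticSolenoidalCellTensorQ.Negative.PrincipalRest
import Summits.AnomalousDissipation.AnomalousDissipation.Theorems.SolenoidalFractalHomogenisationRealisedQuasiStaticCellLawSectorWindow
import HarnessLib

/-!
# Negative side of K2Q `QuasiStaticSolenoidalCellTensorQ` (stmt-AnomalousDissipation-19072): the AM–GM exchange bound of the
# principal pair against the rest dissipation (helper, `--supports stmt-AnomalousDissipation-19072`)

Summits-side helper file (everything proved; no definitions, no named facts).  The exchange term `τ` of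
`principalEnergy_hasDerivWithinAt` (ladder form: the principal modes `±ℓ` are fed only by `±ℓ ∓ K_j` in slot `j`) is
bounded by AM–GM against the dissipation of those four rest modes:
* `exchange_mode_le` — one mode, one layer: `|2Re⟪v, C•Π_k(A•u₁ + A'•u₂)⟫| ≤ Σ_σ (‖C‖‖A_σ‖‖Π_{m_σ}v‖)²/w_σ + Σ_σ w_σ‖u_σ‖²`
  (Leray symbol invisible against transversal vectors; the polarisation factor `‖Π_{m_σ} v‖` is kept);
* `exchange_layer_le` — the principal pair against one layer: the four fed modes are distinct rest modes, so their
  weighted energies are dominated by HALF the rest dissipation `D = 2κ·4π² Σ_{rest} |k|²‖α(k)‖²`;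
* `restGap_le` — the rest of a low sector (`2|ℓ| ≤ n`) has the spectral gap `2κ4π²(n/2)²`: `Λ·R ≤ D`.
This is NOT a proof of anomalous dissipation, and by itself not of `¬ K2Q`.
-/

set_option linter.dupNamespace false

noncomputable section

namespace Summit.AnomalousDissipation.AnomalousDissipation.Theorems.QuasiStaticSolenoidalCellTensorQ.Negative

open Set MeasureTheory Filter Topology Function
open scoped InnerProductSpace ComplexConjugate BigOperators
open Literature.Analysis Literature.Analysis.FunctionSpaces Literature.Analysis.FunctionSpaces.Torus
open Literature.Analysis.FluidPDE Literature.Analysis.FluidPDE.LatticeShear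
open Summit.AnomalousDissipation.AnomalousDissipation.Theorems.SolenoidalFractalHomogenisation.PermissibleCarrier
open Summit.AnomalousDissipation.AnomalousDissipation.Theorems.SolenoidalFractalHomogenisation.RealisedQuasiStaticCellLaw

variable {k₀ : ℕ}

/-! ## §1 AM–GM for one mode against one layer -/

/-- AM–GM with a weight: `2ab ≤ a²/w + w b²` for `w > 0`. -/
theorem two_mul_le_sq_div_add {a b w : ℝ} (hw : 0 < w) : 2 * a * b ≤ a ^ 2 / w + w * b ^ 2 := by
  have h : 0 ≤ (a / w - b) ^ 2 * w := mul_nonneg (sq_nonneg _) hw.le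
  have e : (a / w - b) ^ 2 * w = a ^ 2 / w + w * b ^ 2 - 2 * a * b := by field_simp; ring
  linarith [e ▸ h]

/-- **One principal mode against one layer.** For `v` transversal to `k`, `u₁, u₂` transversal to `m₁, m₂`, scalars
`C, A, A'` and weights `w₁, w₂ > 0`:
`|2Re⟪v, C•Π_k(A•u₁ + A'•u₂)⟫| ≤ (‖C‖‖A‖‖Π_{m₁}v‖)²/w₁ + w₁‖u₁‖² + (‖C‖‖A'‖‖Π_{m₂}v‖)²/w₂ + w₂‖u₂‖²`. -/
theorem exchange_mode_le (v u₁ u₂ : EuclideanSpace ℂ (Fin 3)) (k m₁ m₂ : Fin 3 → ℤ)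
    (hv : ∑ i, (k i : ℂ) * v i = 0) (hu₁ : ∑ i, (m₁ i : ℂ) * u₁ i = 0) (hu₂ : ∑ i, (m₂ i : ℂ) * u₂ i = 0)
    (C A A' : ℂ) {w₁ w₂ : ℝ} (hw₁ : 0 < w₁) (hw₂ : 0 < w₂) :
    |2 * (inner ℂ v (C • Torus.leraySym k (A • u₁ + A' • u₂))).re| ≤
      (‖C‖ * ‖A‖ * ‖Torus.leraySym m₁ v‖) ^ 2 / w₁ + w₁ * ‖u₁‖ ^ 2 +
        ((‖C‖ * ‖A'‖ * ‖Torus.leraySym m₂ v‖) ^ 2 / w₂ + w₂ * ‖u₂‖ ^ 2) := by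
  have h1 : inner ℂ v (C • Torus.leraySym k (A • u₁ + A' • u₂)) = C * (A * inner ℂ v u₁ + A' * inner ℂ v u₂) := by
    rw [inner_smul_right, Torus.inner_leraySym_right_of_transversal k _ hv, inner_add_right, inner_smul_right,
      inner_smul_right]
  have h2 : inner ℂ v u₁ = inner ℂ (Torus.leraySym m₁ v) u₁ := (Torus.inner_leraySym_left_of_transversal m₁ v hu₁).symm
  have h3 : inner ℂ v u₂ = inner ℂ (Torus.leraySym m₂ v) u₂ := (Torus.inner_leraySym_left_of_transversal m₂ v hu₂).symm
  rw [h1, h2, h3]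
  have hb1 : ‖inner ℂ (Torus.leraySym m₁ v) u₁‖ ≤ ‖Torus.leraySym m₁ v‖ * ‖u₁‖ := norm_inner_le_norm _ _
  have hb2 : ‖inner ℂ (Torus.leraySym m₂ v) u₂‖ ≤ ‖Torus.leraySym m₂ v‖ * ‖u₂‖ := norm_inner_le_norm _ _
  have hz : ‖C * (A * inner ℂ (Torus.leraySym m₁ v) u₁ + A' * inner ℂ (Torus.leraySym m₂ v) u₂)‖ ≤
      ‖C‖ * (‖A‖ * (‖Torus.leraySym m₁ v‖ * ‖u₁‖) + ‖A'‖ * (‖Torus.leraySym m₂ v‖ * ‖u₂‖)) := by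
    rw [norm_mul]
    refine mul_le_mul_of_nonneg_left ((norm_add_le _ _).trans (add_le_add ?_ ?_)) (norm_nonneg _)
    · rw [norm_mul]; exact mul_le_mul_of_nonneg_left hb1 (norm_nonneg _)
    · rw [norm_mul]; exact mul_le_mul_of_nonneg_left hb2 (norm_nonneg _)
  have hre := Complex.abs_re_le_norm (C * (A * inner ℂ (Torus.leraySym m₁ v) u₁ + A' * inner ℂ (Torus.leraySym m₂ v) u₂))
  have ham1 := two_mul_le_sq_div_add (a := ‖C‖ * ‖A‖ * ‖Torus.leraySym m₁ v‖) (b := ‖u₁‖) hw₁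
  have ham2 := two_mul_le_sq_div_add (a := ‖C‖ * ‖A'‖ * ‖Torus.leraySym m₂ v‖) (b := ‖u₂‖) hw₂
  rw [abs_mul, abs_of_pos (by norm_num : (0:ℝ) < 2)]
  nlinarith [abs_nonneg ((C * (A * inner ℂ (Torus.leraySym m₁ v) u₁ + A' * inner ℂ (Torus.leraySym m₂ v) u₂)).re)]

/-! ## §2 The principal pair against one layer: the four fed modes are rest modes -/

/-- **The principal pair against one layer.** For a transversal coefficient family `α`, a principal label `ℓ ≠ -ℓ`, a
layer frequency `K`, coefficients `C : (Fin 3 → ℤ) → ℂ`, `A, A'`, viscosity `κ > 0`, and a finite set `S` of REST modes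
containing the four fed modes `±ℓ ∓ K`, pairwise distinct and non-zero:
`|Σ_{k=±ℓ} 2Re⟪α k, C k•Π_k(A•α(k-K) + A'•α(k+K))⟫| ≤
   Σ_{k=±ℓ} ‖C k‖²(‖A‖²‖Π_{k-K}α k‖²/(κ4π²|k-K|²) + ‖A'‖²‖Π_{k+K}α k‖²/(κ4π²|k+K|²)) + κ4π² Σ_{k'∈S} |k'|²‖α k'‖²`. -/
theorem exchange_layer_le (α : (Fin 3 → ℤ) → EuclideanSpace ℂ (Fin 3)) (hα : ∀ k, ∑ i, (k i : ℂ) * α k i = 0)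
    {ℓ K : Fin 3 → ℤ} (hℓℓ : ℓ ≠ -ℓ) (C : (Fin 3 → ℤ) → ℂ) (A A' : ℂ) {κ : ℝ} (hκ : 0 < κ)
    (S : Finset (Fin 3 → ℤ)) (h1 : ℓ - K ∈ S) (h2 : ℓ + K ∈ S) (h3 : -ℓ - K ∈ S) (h4 : -ℓ + K ∈ S)
    (d12 : ℓ - K ≠ ℓ + K) (d13 : ℓ - K ≠ -ℓ - K) (d14 : ℓ - K ≠ -ℓ + K) (d23 : ℓ + K ≠ -ℓ - K)
    (d24 : ℓ + K ≠ -ℓ + K) (d34 : -ℓ - K ≠ -ℓ + K)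
    (z1 : ℓ - K ≠ 0) (z2 : ℓ + K ≠ 0) (z3 : -ℓ - K ≠ 0) (z4 : -ℓ + K ≠ 0) :
    |∑ k ∈ ({ℓ, -ℓ} : Finset (Fin 3 → ℤ)),
        2 * (inner ℂ (α k) (C k • Torus.leraySym k (A • α (k - K) + A' • α (k + K)))).re| ≤
      ∑ k ∈ ({ℓ, -ℓ} : Finset (Fin 3 → ℤ)), ‖C k‖ ^ 2 *
          (‖A‖ ^ 2 * ‖Torus.leraySym (k - K) (α k)‖ ^ 2 / (κ * (4 * Real.pi ^ 2 * freqNormSq (k - K))) +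
            ‖A'‖ ^ 2 * ‖Torus.leraySym (k + K) (α k)‖ ^ 2 / (κ * (4 * Real.pi ^ 2 * freqNormSq (k + K)))) +
        κ * (4 * Real.pi ^ 2 * ∑ k' ∈ S, freqNormSq k' * ‖α k'‖ ^ 2) := by
  have hw : ∀ m : Fin 3 → ℤ, m ≠ 0 → 0 < κ * (4 * Real.pi ^ 2 * freqNormSq m) := fun m hm => by
    have : 0 < freqNormSq m := lt_of_lt_of_le one_pos (one_le_freqNormSq_of_ne_zero hm)
    positivity
  -- one mode at a time
  have hmode : ∀ k : Fin 3 → ℤ, k - K ≠ 0 → k + K ≠ 0 →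
      |2 * (inner ℂ (α k) (C k • Torus.leraySym k (A • α (k - K) + A' • α (k + K)))).re| ≤
        ‖C k‖ ^ 2 * (‖A‖ ^ 2 * ‖Torus.leraySym (k - K) (α k)‖ ^ 2 / (κ * (4 * Real.pi ^ 2 * freqNormSq (k - K))) +
            ‖A'‖ ^ 2 * ‖Torus.leraySym (k + K) (α k)‖ ^ 2 / (κ * (4 * Real.pi ^ 2 * freqNormSq (k + K)))) +
          (κ * (4 * Real.pi ^ 2 * freqNormSq (k - K)) * ‖α (k - K)‖ ^ 2 +
            κ * (4 * Real.pi ^ 2 * freqNormSq (k + K)) * ‖α (k + K)‖ ^ 2) := by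
    intro k hk1 hk2
    have h := exchange_mode_le (α k) (α (k - K)) (α (k + K)) k (k - K) (k + K) (hα k) (hα (k - K)) (hα (k + K))
      (C k) A A' (hw _ hk1) (hw _ hk2)
    have e : (‖C k‖ * ‖A‖ * ‖Torus.leraySym (k - K) (α k)‖) ^ 2 / (κ * (4 * Real.pi ^ 2 * freqNormSq (k - K))) +
          κ * (4 * Real.pi ^ 2 * freqNormSq (k - K)) * ‖α (k - K)‖ ^ 2 +
        ((‖C k‖ * ‖A'‖ * ‖Torus.leraySym (k + K) (α k)‖) ^ 2 / (κ * (4 * Real.pi ^ 2 * freqNormSq (k + K))) +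
          κ * (4 * Real.pi ^ 2 * freqNormSq (k + K)) * ‖α (k + K)‖ ^ 2) =
        ‖C k‖ ^ 2 * (‖A‖ ^ 2 * ‖Torus.leraySym (k - K) (α k)‖ ^ 2 / (κ * (4 * Real.pi ^ 2 * freqNormSq (k - K))) +
            ‖A'‖ ^ 2 * ‖Torus.leraySym (k + K) (α k)‖ ^ 2 / (κ * (4 * Real.pi ^ 2 * freqNormSq (k + K)))) +
          (κ * (4 * Real.pi ^ 2 * freqNormSq (k - K)) * ‖α (k - K)‖ ^ 2 +
            κ * (4 * Real.pi ^ 2 * freqNormSq (k + K)) * ‖α (k + K)‖ ^ 2) := by ring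
    rw [e] at h
    exact h
  rw [Finset.sum_pair hℓℓ, Finset.sum_pair hℓℓ]
  have hℓ' := hmode ℓ z1 z2
  have hℓ'' := hmode (-ℓ) z3 z4
  -- the four fed modes inside the rest sum
  set g : (Fin 3 → ℤ) → ℝ := fun k' => freqNormSq k' * ‖α k'‖ ^ 2 with hg
  have hg0 : ∀ k' ∈ S, 0 ≤ g k' := fun k' _ => by
    rw [hg]; exact mul_nonneg (freqNormSq_nonneg k') (sq_nonneg _)
  have hsub : ({ℓ - K, ℓ + K, -ℓ - K, -ℓ + K} : Finset (Fin 3 → ℤ)) ⊆ S := by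
    intro k' hk'
    simp only [Finset.mem_insert, Finset.mem_singleton] at hk'
    rcases hk' with rfl | rfl | rfl | rfl
    · exact h1
    · exact h2
    · exact h3
    · exact h4
  have hfour : ∑ k' ∈ ({ℓ - K, ℓ + K, -ℓ - K, -ℓ + K} : Finset (Fin 3 → ℤ)), g k' =
      g (ℓ - K) + g (ℓ + K) + g (-ℓ - K) + g (-ℓ + K) := by
    rw [Finset.sum_insert (by simp [d12, d13, d14]), Finset.sum_insert (by simp [d23, d24]),
      Finset.sum_pair d34]
    ring
  have hle : g (ℓ - K) + g (ℓ + K) + g (-ℓ - K) + g (-ℓ + K) ≤ ∑ k' ∈ S, g k' := by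
    rw [← hfour]
    exact Finset.sum_le_sum_of_subset_of_nonneg hsub fun k' hk' _ => hg0 k' hk'
  have hκ4 : 0 ≤ κ * (4 * Real.pi ^ 2) := by positivity
  have eg : ∀ k' : Fin 3 → ℤ, κ * (4 * Real.pi ^ 2 * freqNormSq k') * ‖α k'‖ ^ 2 = κ * (4 * Real.pi ^ 2) * g k' := by
    intro k'; rw [hg]; ring
  rw [eg, eg] at hℓ'
  rw [eg, eg] at hℓ''
  have hsumS : κ * (4 * Real.pi ^ 2 * ∑ k' ∈ S, freqNormSq k' * ‖α k'‖ ^ 2) = κ * (4 * Real.pi ^ 2) * ∑ k' ∈ S, g k' := by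
    rw [hg]; ring
  rw [hsumS]
  have habs := abs_add_le (2 * (inner ℂ (α ℓ) (C ℓ • Torus.leraySym ℓ (A • α (ℓ - K) + A' • α (ℓ + K)))).re)
    (2 * (inner ℂ (α (-ℓ)) (C (-ℓ) • Torus.leraySym (-ℓ) (A • α (-ℓ - K) + A' • α (-ℓ + K)))).re)
  nlinarith [mul_le_mul_of_nonneg_left hle hκ4]

/-! ## §3 The spectral gap of the rest of a low sector -/

/-- **Rest gap.** In the sector `±ℓ + nℤ³` with `2|ℓ| ≤ n`, every mode of the truncation other than `±ℓ` where the
approximation does not vanish has `|k|² ≥ (n/2)²`; hence `Λ·R ≤ D` with `Λ = 2κ4π²(n/2)²`,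
`R = Σ_{rest} ‖α‖²`, `D = 2κ4π² Σ_{rest} |k|²‖α‖²`. -/
theorem restGap_le (W : LatticeWord k₀) {n : ℕ} (hn : 0 < n) {κ : ℝ} (hκ : 0 ≤ κ)
    (ℓ : Fin 3 → ℤ) (hℓn : 2 * ‖latticeVec ℓ‖ ≤ n) {w₀ : UnitAddTorus (Fin 3) → EuclideanSpace ℝ (Fin 3)}
    (hw₀ : FunctionSpaces.Torus.MemSobolev 1 (FunctionSpaces.EuclideanSpace.complexify ∘ w₀))
    (hdiv : FunctionSpaces.Torus.IsWeaklyDivFree w₀) (hmean : FunctionSpaces.Torus.HasZeroMean w₀)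
    (hsupp : ∀ k : Fin 3 → ℤ, ¬ ((∃ z : Fin 3 → ℤ, k = ℓ + (n:ℤ) • z) ∨ (∃ z : Fin 3 → ℤ, k = -ℓ + (n:ℤ) • z)) →
      UnitAddTorus.mFourierCoeff (FunctionSpaces.EuclideanSpace.complexify ∘ w₀) k = 0)
    (N : ℕ) (t : ℝ) :
    2 * (κ * (4 * Real.pi ^ 2 * ((n : ℝ) / 2) ^ 2)) *
        ∑ k ∈ freqBall N \ {ℓ, -ℓ}, ‖(pvSetup_cell W hn hκ ℓ hw₀ hdiv hmean hsupp).galerkinCoeffAt N t k‖ ^ 2 ≤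
      2 * (κ * (4 * Real.pi ^ 2 * ∑ k ∈ freqBall N \ {ℓ, -ℓ},
        freqNormSq k * ‖(pvSetup_cell W hn hκ ℓ hw₀ hdiv hmean hsupp).galerkinCoeffAt N t k‖ ^ 2)) := by
  classical
  set hPV := pvSetup_cell W hn hκ ℓ hw₀ hdiv hmean hsupp with hPVdef
  have key : ((n : ℝ) / 2) ^ 2 * ∑ k ∈ freqBall N \ {ℓ, -ℓ}, ‖hPV.galerkinCoeffAt N t k‖ ^ 2 ≤
      ∑ k ∈ freqBall N \ {ℓ, -ℓ}, freqNormSq k * ‖hPV.galerkinCoeffAt N t k‖ ^ 2 := by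
    rw [Finset.mul_sum]
    refine Finset.sum_le_sum fun k hk => ?_
    by_cases h0 : hPV.galerkinCoeffAt N t k = 0
    · rw [h0, norm_zero]; simp
    · have hsec : k ∈ {k : Fin 3 → ℤ | (∃ z : Fin 3 → ℤ, k = ℓ + (n:ℤ) • z) ∨ (∃ z : Fin 3 → ℤ, k = -ℓ + (n:ℤ) • z)} := by
        by_contra hks
        exact h0 (hPV.galerkinCoeffAt_eq_zero N t (Or.inl hks))
      rw [Finset.mem_sdiff, Finset.mem_insert, Finset.mem_singleton, not_or] at hk
      have hlow : ((n : ℝ) / 2) ^ 2 ≤ freqNormSq k := by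
        rcases hsec with ⟨z, hz⟩ | ⟨z, hz⟩
        · have hz0 : z ≠ 0 := by rintro rfl; exact hk.2.1 (by rw [hz]; simp)
          exact half_le_norm_of_sector hz0 hℓn (Or.inl hz)
        · have hz0 : z ≠ 0 := by rintro rfl; exact hk.2.2 (by rw [hz]; simp)
          exact half_le_norm_of_sector hz0 hℓn (Or.inr hz)
      exact mul_le_mul_of_nonneg_right hlow (sq_nonneg _)
  have hc : 0 ≤ 2 * (κ * (4 * Real.pi ^ 2)) := by positivity
  calc 2 * (κ * (4 * Real.pi ^ 2 * ((n : ℝ) / 2) ^ 2)) *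
        ∑ k ∈ freqBall N \ {ℓ, -ℓ}, ‖hPV.galerkinCoeffAt N t k‖ ^ 2
      = 2 * (κ * (4 * Real.pi ^ 2)) * (((n : ℝ) / 2) ^ 2 * ∑ k ∈ freqBall N \ {ℓ, -ℓ}, ‖hPV.galerkinCoeffAt N t k‖ ^ 2) := by
        ring
    _ ≤ 2 * (κ * (4 * Real.pi ^ 2)) * ∑ k ∈ freqBall N \ {ℓ, -ℓ}, freqNormSq k * ‖hPV.galerkinCoeffAt N t k‖ ^ 2 :=
        mul_le_mul_of_nonneg_left key hc
    _ = 2 * (κ * (4 * Real.pi ^ 2 * ∑ k ∈ freqBall N \ {ℓ, -ℓ},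
        freqNormSq k * ‖hPV.galerkinCoeffAt N t k‖ ^ 2)) := by ring

/-! ## §4 The four fed modes of a slot are distinct rest modes -/

/-- Base facts for a low principal label against a cell frequency `K_j = n m_j`: `K_j ≠ 0`, `ℓ ≠ ±K_j`, `2ℓ ≠ ±K_j`
(`|ℓ|, |2ℓ| < n ≤ |K_j|`). -/
theorem principal_ne_cellFreq (P : LatticePhase) {n : ℕ} (hn : 0 < n) {ℓ : Fin 3 → ℤ}
    (hℓn : 2 * ‖latticeVec ℓ‖ < n) :
    (fun i => P.m i * (n : ℤ)) ≠ 0 ∧ ℓ ≠ (fun i => P.m i * (n : ℤ)) ∧ ℓ ≠ -(fun i => P.m i * (n : ℤ)) ∧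
      ℓ + ℓ ≠ (fun i => P.m i * (n : ℤ)) ∧ ℓ + ℓ ≠ -(fun i => P.m i * (n : ℤ)) := by
  have hK0 := cellFreq_ne_zero P hn
  have hKn : (n : ℝ) ≤ ‖latticeVec (fun i => P.m i * (n : ℤ))‖ := by
    have hnz : latticeVec (fun i => P.m i * (n : ℤ)) = (n : ℝ) • latticeVec P.m := by
      ext i; simp [latticeVec_apply, mul_comm]
    rw [hnz, norm_smul, Real.norm_eq_abs, abs_of_nonneg (Nat.cast_nonneg n)]
    have := one_le_norm_latticeVec P.m_ne
    have hn' : (0 : ℝ) ≤ n := Nat.cast_nonneg n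
    nlinarith
  have hneg : ‖latticeVec (-(fun i => P.m i * (n : ℤ)))‖ = ‖latticeVec (fun i => P.m i * (n : ℤ))‖ := by
    rw [latticeVec_neg, norm_neg]
  have h2 : ‖latticeVec (ℓ + ℓ)‖ = 2 * ‖latticeVec ℓ‖ := by
    rw [latticeVec_add, ← two_smul ℝ, norm_smul, Real.norm_eq_abs, abs_of_pos (by norm_num : (0:ℝ) < 2)]
  have hℓ0 : 0 ≤ ‖latticeVec ℓ‖ := norm_nonneg _
  refine ⟨hK0, ?_, ?_, ?_, ?_⟩
  · intro h; have := congrArg (fun v => ‖latticeVec v‖) h; linarith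
  · intro h; have := congrArg (fun v => ‖latticeVec v‖) h; rw [hneg] at this; linarith
  · intro h; have := congrArg (fun v => ‖latticeVec v‖) h; rw [h2] at this; linarith
  · intro h; have := congrArg (fun v => ‖latticeVec v‖) h; rw [h2, hneg] at this; linarith

/-- **The four fed modes `±ℓ ∓ K` are pairwise distinct, non-zero, and none is `±ℓ`** (for `2|ℓ| < n ≤ |K|`,
`ℓ ≠ 0`). -/
theorem fourModes_facts (P : LatticePhase) {n : ℕ} (hn : 0 < n) {ℓ : Fin 3 → ℤ} (hℓ : ℓ ≠ 0)
    (hℓn : 2 * ‖latticeVec ℓ‖ < n) :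
    (ℓ - (fun i => P.m i * (n : ℤ)) ≠ ℓ + (fun i => P.m i * (n : ℤ)) ∧
      ℓ - (fun i => P.m i * (n : ℤ)) ≠ -ℓ - (fun i => P.m i * (n : ℤ)) ∧
      ℓ - (fun i => P.m i * (n : ℤ)) ≠ -ℓ + (fun i => P.m i * (n : ℤ)) ∧
      ℓ + (fun i => P.m i * (n : ℤ)) ≠ -ℓ - (fun i => P.m i * (n : ℤ)) ∧
      ℓ + (fun i => P.m i * (n : ℤ)) ≠ -ℓ + (fun i => P.m i * (n : ℤ)) ∧
      -ℓ - (fun i => P.m i * (n : ℤ)) ≠ -ℓ + (fun i => P.m i * (n : ℤ))) ∧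
    (ℓ - (fun i => P.m i * (n : ℤ)) ≠ 0 ∧ ℓ + (fun i => P.m i * (n : ℤ)) ≠ 0 ∧
      -ℓ - (fun i => P.m i * (n : ℤ)) ≠ 0 ∧ -ℓ + (fun i => P.m i * (n : ℤ)) ≠ 0) ∧
    (ℓ - (fun i => P.m i * (n : ℤ)) ∉ ({ℓ, -ℓ} : Finset (Fin 3 → ℤ)) ∧
      ℓ + (fun i => P.m i * (n : ℤ)) ∉ ({ℓ, -ℓ} : Finset (Fin 3 → ℤ)) ∧
      -ℓ - (fun i => P.m i * (n : ℤ)) ∉ ({ℓ, -ℓ} : Finset (Fin 3 → ℤ)) ∧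
      -ℓ + (fun i => P.m i * (n : ℤ)) ∉ ({ℓ, -ℓ} : Finset (Fin 3 → ℤ))) := by
  obtain ⟨hK0, hℓK, hℓK', h2K, h2K'⟩ := principal_ne_cellFreq P hn hℓn
  set K : Fin 3 → ℤ := fun i => P.m i * (n : ℤ) with hKdef
  -- componentwise reductions
  have cK0 : ¬ (∀ i, K i = 0) := fun h => hK0 (funext h); have cℓ0 : ¬ (∀ i, ℓ i = 0) := fun h => hℓ (funext h)
  have cℓK : ¬ (∀ i, ℓ i = K i) := fun h => hℓK (funext h)
  have cℓK' : ¬ (∀ i, ℓ i = -K i) := fun h => hℓK' (funext fun i => by rw [Pi.neg_apply]; exact h i)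
  have c2K : ¬ (∀ i, ℓ i + ℓ i = K i) := fun h => h2K (funext fun i => by rw [Pi.add_apply]; exact h i)
  have c2K' : ¬ (∀ i, ℓ i + ℓ i = -K i) := fun h => h2K' (funext fun i => by rw [Pi.add_apply, Pi.neg_apply]; exact h i)
  have key : ∀ {u v : Fin 3 → ℤ}, u = v → ∀ i, u i = v i := fun h i => congrFun h i
  refine ⟨⟨?_, ?_, ?_, ?_, ?_, ?_⟩, ⟨?_, ?_, ?_, ?_⟩, ?_, ?_, ?_, ?_⟩
  · intro h; apply cK0; intro i; have := key h i; simp only [Pi.sub_apply, Pi.add_apply] at this; omega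
  · intro h; apply cℓ0; intro i; have := key h i; simp only [Pi.sub_apply, Pi.neg_apply] at this; omega
  · intro h; apply cℓK; intro i; have := key h i; simp only [Pi.sub_apply, Pi.add_apply, Pi.neg_apply] at this; omega
  · intro h; apply cℓK'; intro i; have := key h i; simp only [Pi.sub_apply, Pi.add_apply, Pi.neg_apply] at this; omega
  · intro h; apply cℓ0; intro i; have := key h i; simp only [Pi.add_apply, Pi.neg_apply] at this; omega
  · intro h; apply cK0; intro i; have := key h i; simp only [Pi.sub_apply, Pi.add_apply, Pi.neg_apply] at this; omega
  · intro h; apply cℓK; intro i; have := key h i; simp only [Pi.sub_apply, Pi.zero_apply] at this; omega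
  · intro h; apply cℓK'; intro i; have := key h i; simp only [Pi.add_apply, Pi.zero_apply] at this; omega
  · intro h; apply cℓK'; intro i; have := key h i; simp only [Pi.sub_apply, Pi.neg_apply, Pi.zero_apply] at this; omega
  · intro h; apply cℓK; intro i; have := key h i; simp only [Pi.add_apply, Pi.neg_apply, Pi.zero_apply] at this; omega
  all_goals
    simp only [Finset.mem_insert, Finset.mem_singleton, not_or]
    refine ⟨fun h => ?_, fun h => ?_⟩
  · apply cK0; intro i; have := key h i; simp only [Pi.sub_apply] at this; omega
  · apply c2K; intro i; have := key h i; simp only [Pi.sub_apply, Pi.neg_apply] at this; omega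
  · apply cK0; intro i; have := key h i; simp only [Pi.add_apply] at this; omega
  · apply c2K'; intro i; have := key h i; simp only [Pi.add_apply, Pi.neg_apply] at this; omega
  · apply c2K'; intro i; have := key h i; simp only [Pi.sub_apply, Pi.neg_apply] at this; omega
  · apply cK0; intro i; have := key h i; simp only [Pi.sub_apply, Pi.neg_apply] at this; omega
  · apply c2K; intro i; have := key h i; simp only [Pi.add_apply, Pi.neg_apply] at this; omega
  · apply cK0; intro i; have := key h i; simp only [Pi.add_apply, Pi.neg_apply] at this; omega

/-! ## §5 The exchange bound of the cell truncation: `|τ| ≤ 2ψ + D/2` -/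

set_option maxHeartbeats 800000 in
/-- **The AM–GM exchange bound of the cell truncation.** For `κ > 0`, a principal label `ℓ ≠ 0` with `2|ℓ| < n`, and a
truncation order `N` resolving the four fed modes `±ℓ ∓ K_j` of every slot, the exchange term `τ(t)` of
`principalEnergy_hasDerivWithinAt` satisfies `|τ(t)| ≤ 2ψ(t) + D(t)/2` with the Taylor drain density
`ψ(t) = ½ Σ_j Σ_{k=±ℓ} ‖C_j(t,k)‖² (‖a_j‖²‖Π_{k-K_j}α(k)‖²/(κ4π²|k-K_j|²) + ‖a'_j‖²‖Π_{k+K_j}α(k)‖²/(κ4π²|k+K_j|²))`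
(`C_j(t,k) = (trap_j(t)/n)·2πi(ê_j·k)`; only the active slot contributes) and the rest dissipation
`D(t) = 2κ4π² Σ_{k∈freqBall N∖{±ℓ}} |k|²‖α(k)‖²`. -/
theorem exchange_le_cell (W : LatticeWord k₀) {n : ℕ} (hn : 0 < n) {κ : ℝ} (hκ : 0 < κ)
    (ℓ : Fin 3 → ℤ) (hℓ : ℓ ≠ 0) (hℓn : 2 * ‖latticeVec ℓ‖ < n) {w₀ : UnitAddTorus (Fin 3) → EuclideanSpace ℝ (Fin 3)}
    (hw₀ : FunctionSpaces.Torus.MemSobolev 1 (FunctionSpaces.EuclideanSpace.complexify ∘ w₀))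
    (hdiv : FunctionSpaces.Torus.IsWeaklyDivFree w₀) (hmean : FunctionSpaces.Torus.HasZeroMean w₀)
    (hsupp : ∀ k : Fin 3 → ℤ, ¬ ((∃ z : Fin 3 → ℤ, k = ℓ + (n:ℤ) • z) ∨ (∃ z : Fin 3 → ℤ, k = -ℓ + (n:ℤ) • z)) →
      UnitAddTorus.mFourierCoeff (FunctionSpaces.EuclideanSpace.complexify ∘ w₀) k = 0)
    {N : ℕ} (hball : ∀ j : Fin k₀, ∀ k ∈ ({ℓ, -ℓ} : Finset (Fin 3 → ℤ)),
      k - (fun i => (W.phase j).m i * (n : ℤ)) ∈ freqBall N ∧ k + (fun i => (W.phase j).m i * (n : ℤ)) ∈ freqBall N)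
    (t : ℝ) :
    |(-(∑ k ∈ ({ℓ, -ℓ} : Finset (Fin 3 → ℤ)), 2 * (inner ℂ ((pvSetup_cell W hn hκ.le ℓ hw₀ hdiv hmean hsupp).galerkinCoeffAt N t k)
          (∑ j : Fin k₀, ((((1 / (n : ℝ)) *
            LatticeWord.trapezoid (W.start j) (W.phase j).τ W.ramp (Int.fract (t / W.period) * W.period) : ℝ) : ℂ) *
            (2 * Real.pi * Complex.I * ∑ i, (EuclideanSpace.complexify (W.phase j).e) i * (k i : ℂ))) •
          Torus.leraySym k
            ((Complex.exp ((W.phase j).φ * Complex.I) *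
                (1 / (2 * ((2 * Real.pi * ‖latticeVec (W.phase j).m‖ : ℝ) : ℂ) * Complex.I))) •
                (pvSetup_cell W hn hκ.le ℓ hw₀ hdiv hmean hsupp).galerkinCoeffAt N t (k - (fun i => (W.phase j).m i * n)) +
              (starRingEnd ℂ (Complex.exp ((W.phase j).φ * Complex.I)) *
                (-(1 / (2 * ((2 * Real.pi * ‖latticeVec (W.phase j).m‖ : ℝ) : ℂ) * Complex.I)))) •
                (pvSetup_cell W hn hκ.le ℓ hw₀ hdiv hmean hsupp).galerkinCoeffAt N t (k + (fun i => (W.phase j).m i * n))))).re))| ≤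
      2 * ((1 / 2 : ℝ) * ∑ j : Fin k₀, ∑ k ∈ ({ℓ, -ℓ} : Finset (Fin 3 → ℤ)),
          ‖((((1 / (n : ℝ)) *
            LatticeWord.trapezoid (W.start j) (W.phase j).τ W.ramp (Int.fract (t / W.period) * W.period) : ℝ) : ℂ) *
            (2 * Real.pi * Complex.I * ∑ i, (EuclideanSpace.complexify (W.phase j).e) i * (k i : ℂ)))‖ ^ 2 *
          (‖Complex.exp ((W.phase j).φ * Complex.I) *
                (1 / (2 * ((2 * Real.pi * ‖latticeVec (W.phase j).m‖ : ℝ) : ℂ) * Complex.I))‖ ^ 2 *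
              ‖Torus.leraySym (k - (fun i => (W.phase j).m i * n))
                ((pvSetup_cell W hn hκ.le ℓ hw₀ hdiv hmean hsupp).galerkinCoeffAt N t k)‖ ^ 2 /
              (κ * (4 * Real.pi ^ 2 * freqNormSq (k - (fun i => (W.phase j).m i * n)))) +
            ‖starRingEnd ℂ (Complex.exp ((W.phase j).φ * Complex.I)) *
                (-(1 / (2 * ((2 * Real.pi * ‖latticeVec (W.phase j).m‖ : ℝ) : ℂ) * Complex.I)))‖ ^ 2 *
              ‖Torus.leraySym (k + (fun i => (W.phase j).m i * n))
                ((pvSetup_cell W hn hκ.le ℓ hw₀ hdiv hmean hsupp).galerkinCoeffAt N t k)‖ ^ 2 /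
              (κ * (4 * Real.pi ^ 2 * freqNormSq (k + (fun i => (W.phase j).m i * n)))))) +
      (2 * (κ * (4 * Real.pi ^ 2 * ∑ k ∈ freqBall N \ {ℓ, -ℓ},
        freqNormSq k * ‖(pvSetup_cell W hn hκ.le ℓ hw₀ hdiv hmean hsupp).galerkinCoeffAt N t k‖ ^ 2))) / 2 := by
  classical
  set hPV := pvSetup_cell W hn hκ.le ℓ hw₀ hdiv hmean hsupp with hPVdef
  set α := hPV.galerkinCoeffAt N t with hαdef
  set r : ℝ := Int.fract (t / W.period) * W.period with hr
  -- abbreviations for the slot scalars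
  set C : Fin k₀ → (Fin 3 → ℤ) → ℂ := fun j k => ((((1 / (n : ℝ)) *
      LatticeWord.trapezoid (W.start j) (W.phase j).τ W.ramp r : ℝ) : ℂ) *
      (2 * Real.pi * Complex.I * ∑ i, (EuclideanSpace.complexify (W.phase j).e) i * (k i : ℂ))) with hC
  set A : Fin k₀ → ℂ := fun j => Complex.exp ((W.phase j).φ * Complex.I) *
      (1 / (2 * ((2 * Real.pi * ‖latticeVec (W.phase j).m‖ : ℝ) : ℂ) * Complex.I)) with hA
  set A' : Fin k₀ → ℂ := fun j => starRingEnd ℂ (Complex.exp ((W.phase j).φ * Complex.I)) *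
      (-(1 / (2 * ((2 * Real.pi * ‖latticeVec (W.phase j).m‖ : ℝ) : ℂ) * Complex.I))) with hA'
  set K : Fin k₀ → (Fin 3 → ℤ) := fun j => fun i => (W.phase j).m i * (n : ℤ) with hK
  -- the per-slot drain terms are non-negative
  have hterm0 : ∀ j, ∀ k : Fin 3 → ℤ, 0 ≤ ‖C j k‖ ^ 2 *
      (‖A j‖ ^ 2 * ‖Torus.leraySym (k - K j) (α k)‖ ^ 2 / (κ * (4 * Real.pi ^ 2 * freqNormSq (k - K j))) +
        ‖A' j‖ ^ 2 * ‖Torus.leraySym (k + K j) (α k)‖ ^ 2 / (κ * (4 * Real.pi ^ 2 * freqNormSq (k + K j)))) := by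
    intro j k
    have h1 : 0 ≤ κ * (4 * Real.pi ^ 2 * freqNormSq (k - K j)) := mul_nonneg hκ.le (mul_nonneg (by positivity) (freqNormSq_nonneg _))
    have h2 : 0 ≤ κ * (4 * Real.pi ^ 2 * freqNormSq (k + K j)) := mul_nonneg hκ.le (mul_nonneg (by positivity) (freqNormSq_nonneg _))
    exact mul_nonneg (sq_nonneg _) (add_nonneg (div_nonneg (mul_nonneg (sq_nonneg _) (sq_nonneg _)) h1)
      (div_nonneg (mul_nonneg (sq_nonneg _) (sq_nonneg _)) h2))
  have hψ0 : 0 ≤ ∑ j : Fin k₀, ∑ k ∈ ({ℓ, -ℓ} : Finset (Fin 3 → ℤ)), ‖C j k‖ ^ 2 *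
      (‖A j‖ ^ 2 * ‖Torus.leraySym (k - K j) (α k)‖ ^ 2 / (κ * (4 * Real.pi ^ 2 * freqNormSq (k - K j))) +
        ‖A' j‖ ^ 2 * ‖Torus.leraySym (k + K j) (α k)‖ ^ 2 / (κ * (4 * Real.pi ^ 2 * freqNormSq (k + K j)))) :=
    Finset.sum_nonneg fun j _ => Finset.sum_nonneg fun k _ => hterm0 j k
  have hD0 : 0 ≤ 2 * (κ * (4 * Real.pi ^ 2 * ∑ k ∈ freqBall N \ {ℓ, -ℓ}, freqNormSq k * ‖α k‖ ^ 2)) := by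
    have : 0 ≤ ∑ k ∈ freqBall N \ {ℓ, -ℓ}, freqNormSq k * ‖α k‖ ^ 2 :=
      Finset.sum_nonneg fun k _ => mul_nonneg (freqNormSq_nonneg _) (sq_nonneg _)
    positivity
  show |(-(∑ k ∈ ({ℓ, -ℓ} : Finset (Fin 3 → ℤ)), 2 * (inner ℂ (α k)
      (∑ j : Fin k₀, C j k • Torus.leraySym k (A j • α (k - K j) + A' j • α (k + K j)))).re))| ≤
    2 * ((1 / 2 : ℝ) * ∑ j : Fin k₀, ∑ k ∈ ({ℓ, -ℓ} : Finset (Fin 3 → ℤ)), ‖C j k‖ ^ 2 *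
      (‖A j‖ ^ 2 * ‖Torus.leraySym (k - K j) (α k)‖ ^ 2 / (κ * (4 * Real.pi ^ 2 * freqNormSq (k - K j))) +
        ‖A' j‖ ^ 2 * ‖Torus.leraySym (k + K j) (α k)‖ ^ 2 / (κ * (4 * Real.pi ^ 2 * freqNormSq (k + K j))))) +
      (2 * (κ * (4 * Real.pi ^ 2 * ∑ k ∈ freqBall N \ {ℓ, -ℓ}, freqNormSq k * ‖α k‖ ^ 2))) / 2
  rw [abs_neg]
  by_cases hact : ∃ j₀ : Fin k₀, LatticeWord.trapezoid (W.start j₀) (W.phase j₀).τ W.ramp r ≠ 0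
  · obtain ⟨j₀, hj₀⟩ := hact
    have hCj : ∀ j, j ≠ j₀ → ∀ k, C j k = 0 := by
      intro j hj k
      rw [hC]
      simp only [activeSlot_unique W r (Ne.symm hj) hj₀, mul_zero, Complex.ofReal_zero, zero_mul]
    have hsingle : ∀ k : Fin 3 → ℤ, ∑ j : Fin k₀, C j k • Torus.leraySym k (A j • α (k - K j) + A' j • α (k + K j)) =
        C j₀ k • Torus.leraySym k (A j₀ • α (k - K j₀) + A' j₀ • α (k + K j₀)) := by
      intro k
      rw [Finset.sum_eq_single j₀ (fun j _ hj => by rw [hCj j hj k, zero_smul]) (fun h => absurd (Finset.mem_univ _) h)]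
    simp_rw [hsingle]
    have hℓℓ : ℓ ≠ -ℓ := by
      intro h; apply hℓ; funext i; have hi := congrFun h i; simp only [Pi.neg_apply] at hi
      have : ℓ i = 0 := by omega
      simpa using this
    obtain ⟨⟨d12, d13, d14, d23, d24, d34⟩, ⟨z1, z2, z3, z4⟩, n1, n2, n3, n4⟩ := fourModes_facts (W.phase j₀) hn hℓ hℓn
    have hb1 := hball j₀ ℓ (by simp)
    have hb2 := hball j₀ (-ℓ) (by simp)
    have hm : ∀ {k' : Fin 3 → ℤ}, k' ∈ freqBall N → k' ∉ ({ℓ, -ℓ} : Finset (Fin 3 → ℤ)) → k' ∈ freqBall N \ {ℓ, -ℓ} :=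
      fun h1 h2 => Finset.mem_sdiff.2 ⟨h1, h2⟩
    have h := exchange_layer_le α (hPV.sum_mul_galerkinCoeffAt N t) hℓℓ (C j₀) (A j₀) (A' j₀) hκ (freqBall N \ {ℓ, -ℓ})
      (hm hb1.1 n1) (hm hb1.2 n2) (hm hb2.1 n3) (hm hb2.2 n4) d12 d13 d14 d23 d24 d34 z1 z2 z3 z4
    have hj₀le : ∑ k ∈ ({ℓ, -ℓ} : Finset (Fin 3 → ℤ)), ‖C j₀ k‖ ^ 2 *
        (‖A j₀‖ ^ 2 * ‖Torus.leraySym (k - K j₀) (α k)‖ ^ 2 / (κ * (4 * Real.pi ^ 2 * freqNormSq (k - K j₀))) +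
          ‖A' j₀‖ ^ 2 * ‖Torus.leraySym (k + K j₀) (α k)‖ ^ 2 / (κ * (4 * Real.pi ^ 2 * freqNormSq (k + K j₀)))) ≤
        ∑ j : Fin k₀, ∑ k ∈ ({ℓ, -ℓ} : Finset (Fin 3 → ℤ)), ‖C j k‖ ^ 2 *
        (‖A j‖ ^ 2 * ‖Torus.leraySym (k - K j) (α k)‖ ^ 2 / (κ * (4 * Real.pi ^ 2 * freqNormSq (k - K j))) +
          ‖A' j‖ ^ 2 * ‖Torus.leraySym (k + K j) (α k)‖ ^ 2 / (κ * (4 * Real.pi ^ 2 * freqNormSq (k + K j)))) :=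
      Finset.single_le_sum (f := fun j => ∑ k ∈ ({ℓ, -ℓ} : Finset (Fin 3 → ℤ)), ‖C j k‖ ^ 2 *
        (‖A j‖ ^ 2 * ‖Torus.leraySym (k - K j) (α k)‖ ^ 2 / (κ * (4 * Real.pi ^ 2 * freqNormSq (k - K j))) +
          ‖A' j‖ ^ 2 * ‖Torus.leraySym (k + K j) (α k)‖ ^ 2 / (κ * (4 * Real.pi ^ 2 * freqNormSq (k + K j)))))
        (fun j _ => Finset.sum_nonneg fun k _ => hterm0 j k) (Finset.mem_univ j₀)
    linarith
  · push Not at hact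
    have hC0 : ∀ j k, C j k = 0 := by
      intro j k; rw [hC]; simp only [hact j, mul_zero, Complex.ofReal_zero, zero_mul]
    have hzero : ∑ k ∈ ({ℓ, -ℓ} : Finset (Fin 3 → ℤ)), 2 * (inner ℂ (α k)
        (∑ j : Fin k₀, C j k • Torus.leraySym k (A j • α (k - K j) + A' j • α (k + K j)))).re = 0 := by
      refine Finset.sum_eq_zero fun k _ => ?_
      have : ∑ j : Fin k₀, C j k • Torus.leraySym k (A j • α (k - K j) + A' j • α (k + K j)) = 0 :=
        Finset.sum_eq_zero fun j _ => by rw [hC0 j k, zero_smul]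
      rw [this, inner_zero_right, Complex.zero_re, mul_zero]
    rw [hzero, abs_zero]
    linarith

end Summit.AnomalousDissipation.AnomalousDissipation.Theorems.QuasiStaticSolenoidalCellTensorQ.Negative

end
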